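import Mathlib
import Summits.Ventures.PercRepro2.SwOutAll
import Summits.Ventures.PercRepro2.SwOutSeriesDefs
import Summits.Ventures.PercRepro2.SwOutSeriesContract

/-!
# The series reduction inside an outside class, part 3: the contraction half — edge sets and the
count (blind cell PercRepro2, night-4 g10, 2026-08-25; proofs/NIGHT4-G10.md §2 (a))

For `ζ e₁ = ζ e₂` the red (blue) edges of `C_R(h)` (`C_B(h)`) in `G` are the substitution
`e₂ ↦ {e₁, e₂}` of those in `G/u` (`redEdges_contract_of_same`, `blueEdges_contract_of_same`), and
the same-colour part of a class is in bijection with the contracted class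
(`card_filter_same_eq`); hence the two counts `card_same_red`, `card_same_blue`.
-/

namespace Summit.Ventures.PercRepro2

namespace LocRows

open Hull

variable {V : Type*} {E : Type*} [Fintype E] [DecidableEq E]

open scoped Classical

variable {ends : E → Sym2 V} {u p q : V} {e₁ e₂ : E}

section ContractEdges

variable (hs : IsSeriesAt ends u p q e₁ e₂)
include hs

omit [Fintype E] in
/-- **The red edge set under contraction**: for `ζ e₁ = ζ e₂`, the red edges of `C_R(h)` in `G` are
the substitution `e₂ ↦ {e₁, e₂}` applied to the red edges of `C_R(h)` in `G/u` (any recolouring of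
the loop). -/
theorem redEdges_contract_of_same {h : V} (huh : u ≠ h) {ζ : Config E} (hsame : ζ e₁ = ζ e₂)
    (b : Bool) :
    redEdges ends ζ h =
      contractSub e₁ e₂
        (redEdges (contractSeries ends u p q e₁ e₂) (Function.update ζ e₁ b) h) := by
  set ends' := contractSeries ends u p q e₁ e₂ with hends'
  set ζ' := Function.update ζ e₁ b with hζ'
  have hC : ∀ v, v ≠ u → (v ∈ cluster ends ζ h ↔ v ∈ cluster ends' ζ' h) :=
    fun v hv => mem_cluster_contract_iff_of_same hs hsame b huh.symm hv
  have hCu : u ∈ cluster ends ζ h ↔ (ζ e₁ = true ∧ p ∈ cluster ends' ζ' h) :=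
    mem_cluster_contract_u_iff_of_same hs hsame b huh.symm
  have hu' : u ∉ cluster ends' ζ' h := u_notMem_cluster_contract hs huh.symm
  have hζ'₂ : ζ' e₂ = ζ e₂ := Function.update_of_ne hs.ne.symm b ζ
  have hends'₂ : ends' e₂ = s(p, q) := contractSeries_apply_e₂ hs.ne
  have hends'₁ : ends' e₁ = s(u, u) := contractSeries_apply_e₁
  have hpq : ζ e₂ = true → (p ∈ cluster ends' ζ' h ↔ q ∈ cluster ends' ζ' h) := by
    intro h₂
    have h₂' : ζ' e₂ = true := by rw [hζ'₂]; exact h₂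
    constructor
    · exact fun hp => mem_cluster_of_edge hp h₂' hends'₂
    · exact fun hq => mem_cluster_of_edge hq h₂' (ends_swap hends'₂)
  have hL1 : e₁ ∈ within ends (cluster ends ζ h) ↔ u ∈ cluster ends ζ h ∧ p ∈ cluster ends ζ h :=
    within_iff_of_ends hs.ends₁
  have hL2 : e₂ ∈ within ends (cluster ends ζ h) ↔ u ∈ cluster ends ζ h ∧ q ∈ cluster ends ζ h :=
    within_iff_of_ends hs.ends₂
  have hR2 : e₂ ∈ within ends' (cluster ends' ζ' h) ↔
      p ∈ cluster ends' ζ' h ∧ q ∈ cluster ends' ζ' h := within_iff_of_ends hends'₂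
  have hR1 : e₁ ∉ within ends' (cluster ends' ζ' h) := by
    rw [within_iff_of_ends hends'₁]
    exact fun h' => hu' h'.1
  ext e
  rw [mem_contractSub_iff, mem_redEdges, mem_redEdges]
  by_cases he₁ : e = e₁
  · subst e
    constructor
    · rintro ⟨h₁, hw⟩
      have hp : p ∈ cluster ends' ζ' h := (hC p hs.up.symm).1 (hL1.1 hw).2
      refine Or.inr ⟨rfl, ?_⟩
      rw [mem_redEdges, hζ'₂, ← hsame]
      exact ⟨h₁, hR2.2 ⟨hp, (hpq (hsame ▸ h₁)).1 hp⟩⟩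
    · rintro (⟨_, hw'⟩ | ⟨_, h₂'⟩)
      · exact absurd hw' hR1
      · rw [mem_redEdges, hζ'₂, ← hsame] at h₂'
        obtain ⟨h₁, hw'⟩ := h₂'
        have hp' : p ∈ cluster ends' ζ' h := (hR2.1 hw').1
        exact ⟨h₁, hL1.2 ⟨hCu.2 ⟨h₁, hp'⟩, (hC p hs.up.symm).2 hp'⟩⟩
  by_cases he₂ : e = e₂
  · subst e
    rw [hζ'₂]
    constructor
    · rintro ⟨h₂, hw⟩
      have hq : q ∈ cluster ends' ζ' h := (hC q hs.uq.symm).1 (hL2.1 hw).2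
      refine Or.inl ⟨h₂, hR2.2 ⟨(hpq h₂).2 hq, hq⟩⟩
    · rintro (⟨h₂, hw'⟩ | ⟨h', _⟩)
      · have hq : q ∈ cluster ends ζ h := (hC q hs.uq.symm).2 (hR2.1 hw').2
        have hu : u ∈ cluster ends ζ h := hCu.2 ⟨hsame ▸ h₂, (hR2.1 hw').1⟩
        exact ⟨h₂, hL2.2 ⟨hu, hq⟩⟩
      · exact absurd h' hs.ne.symm
  · have hζ'e : ζ' e = ζ e := Function.update_of_ne he₁ b ζ
    have hends'e : ends' e = ends e := contractSeries_apply_of_ne he₁ he₂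
    rw [hζ'e]
    simp only [he₁, false_and, or_false]
    constructor
    · rintro ⟨he, x, hx, y, hy, hxy⟩
      have hxu : x ≠ u := ne_u_of_mem_ends hs he₁ he₂ (by rw [hxy]; exact Sym2.mem_mk_left x y)
      have hyu : y ≠ u := ne_u_of_mem_ends hs he₁ he₂ (by rw [hxy]; exact Sym2.mem_mk_right x y)
      exact ⟨he, x, (hC x hxu).1 hx, y, (hC y hyu).1 hy, by rw [hends'e]; exact hxy⟩
    · rintro ⟨he, x, hx, y, hy, hxy⟩
      rw [hends'e] at hxy
      have hxu : x ≠ u := ne_u_of_mem_ends hs he₁ he₂ (by rw [hxy]; exact Sym2.mem_mk_left x y)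
      have hyu : y ≠ u := ne_u_of_mem_ends hs he₁ he₂ (by rw [hxy]; exact Sym2.mem_mk_right x y)
      exact ⟨he, x, (hC x hxu).2 hx, y, (hC y hyu).2 hy, hxy⟩

omit [Fintype E] in
/-- **The blue edge set under contraction.** -/
theorem blueEdges_contract_of_same {h : V} (huh : u ≠ h) {ζ : Config E} (hsame : ζ e₁ = ζ e₂) :
    blueEdges ends ζ h =
      contractSub e₁ e₂
        (blueEdges (contractSeries ends u p q e₁ e₂) (Function.update ζ e₁ false) h) := by
  have hsame' : blue ζ e₁ = blue ζ e₂ := by simp [blue, hsame]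
  unfold blueEdges
  rw [blue_update]
  exact redEdges_contract_of_same hs huh hsame' true

end ContractEdges

section ContractCount

variable (hs : IsSeriesAt ends u p q e₁ e₂)
include hs

/-- **The same-colour configurations of a class are in bijection with the contracted class**, for
any pair of predicates that correspond under the canonical map `ζ ↦ ζ[e₁ ↦ false]`. -/
theorem card_filter_same_eq {U : Set V} {ξ : Config E} {l h o : V} (hu : u ∈ U) (hp : p ∈ U)
    (huh : u ≠ h) (hul : u ≠ l) (huo : u ≠ o) (P : Config E → Prop) (P' : Config E → Prop)
    (hPP : ∀ ζ, ζ e₁ = ζ e₂ → (P ζ ↔ P' (Function.update ζ e₁ false))) :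
    ((swOutSide ends l h o U ξ).filter fun ζ => ζ e₁ = ζ e₂ ∧ P ζ).card =
      ((swOutSide (contractSeries ends u p q e₁ e₂) l h o (U \ {u})
        (Function.update ξ e₁ false)).filter fun ζ' => P' ζ').card := by
  refine Finset.card_bij (fun ζ _ => Function.update ζ e₁ false) ?_ ?_ ?_
  · intro ζ hζ
    rw [Finset.mem_filter] at hζ ⊢
    obtain ⟨hζ, hsame, hP⟩ := hζ
    exact ⟨(mem_swOutSide_contract_iff_of_same hs hu hp huh hul huo hsame).1 hζ,
      (hPP ζ hsame).1 hP⟩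
  · intro ζ₁ hζ₁ ζ₂ hζ₂ heq
    rw [Finset.mem_filter] at hζ₁ hζ₂
    funext e
    by_cases he₁ : e = e₁
    · subst e
      have h₁ := congrFun heq e₂
      rw [Function.update_of_ne hs.ne.symm, Function.update_of_ne hs.ne.symm] at h₁
      rw [hζ₁.2.1, hζ₂.2.1]
      exact h₁
    · have := congrFun heq e
      rwa [Function.update_of_ne he₁, Function.update_of_ne he₁] at this
  · intro ζ' hζ'
    rw [Finset.mem_filter] at hζ'
    -- the loop is pinned `false` in the contracted class
    have hpin : ζ' e₁ = false := by
      have hmem := (mem_swOutSide.1 hζ'.1).2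
      rw [mem_outClass] at hmem
      have := hmem.1 e₁ (by rw [mem_touches_contract_iff hs hu hp]; exact fun h' => h'.2 rfl)
      rw [this]; simp
    refine ⟨Function.update ζ' e₁ (ζ' e₂), ?_, ?_⟩
    · have hsame : Function.update ζ' e₁ (ζ' e₂) e₁ = Function.update ζ' e₁ (ζ' e₂) e₂ := by
        rw [Function.update_self, Function.update_of_ne hs.ne.symm]
      have hback : Function.update (Function.update ζ' e₁ (ζ' e₂)) e₁ false = ζ' := by
        rw [Function.update_idem]
        exact (Function.update_eq_self_iff.2 hpin.symm)
      rw [Finset.mem_filter]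
      refine ⟨?_, hsame, ?_⟩
      · rw [mem_swOutSide_contract_iff_of_same hs hu hp huh hul huo hsame, hback]
        exact hζ'.1
      · rw [hPP _ hsame, hback]
        exact hζ'.2
    · rw [Function.update_idem]
      exact Function.update_eq_self_iff.2 hpin.symm

/-- The red-edge count of the same-colour part equals the red-edge count of the contracted class
for the substituted up-set. -/
theorem card_same_red {U : Set V} {ξ : Config E} {l h o : V} (hu : u ∈ U) (hp : p ∈ U)
    (huh : u ≠ h) (hul : u ≠ l) (huo : u ≠ o) (𝓔 : Set (Set E)) :
    ((swOutSide ends l h o U ξ).filter fun ζ => ζ e₁ = ζ e₂ ∧ redEdges ends ζ h ∈ 𝓔).card =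
      ((swOutSide (contractSeries ends u p q e₁ e₂) l h o (U \ {u})
        (Function.update ξ e₁ false)).filter fun ζ' =>
          redEdges (contractSeries ends u p q e₁ e₂) ζ' h ∈ contractSub e₁ e₂ ⁻¹' 𝓔).card := by
  refine card_filter_same_eq hs hu hp huh hul huo _ _ fun ζ hsame => ?_
  rw [Set.mem_preimage, redEdges_contract_of_same hs huh hsame false]

/-- The blue-edge count of the same-colour part equals the blue-edge count of the contracted class
for the substituted up-set. -/
theorem card_same_blue {U : Set V} {ξ : Config E} {l h o : V} (hu : u ∈ U) (hp : p ∈ U)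
    (huh : u ≠ h) (hul : u ≠ l) (huo : u ≠ o) (𝓔 : Set (Set E)) :
    ((swOutSide ends l h o U ξ).filter fun ζ => ζ e₁ = ζ e₂ ∧ blueEdges ends ζ h ∈ 𝓔).card =
      ((swOutSide (contractSeries ends u p q e₁ e₂) l h o (U \ {u})
        (Function.update ξ e₁ false)).filter fun ζ' =>
          blueEdges (contractSeries ends u p q e₁ e₂) ζ' h ∈ contractSub e₁ e₂ ⁻¹' 𝓔).card := by
  refine card_filter_same_eq hs hu hp huh hul huo _ _ fun ζ hsame => ?_
  rw [Set.mem_preimage, blueEdges_contract_of_same hs huh hsame]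

end ContractCount

end LocRows

end Summit.Ventures.PercRepro2
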